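import Mathlib
import HarnessLib
import Summits.AtomisticToContinuum.Crystallization.Theorems.ChartedPlanarOrderRigidityDoor

/-!
# Law-level currency beneath the door: `L`, `L₀`, `BULK_law`, `DILUTE_law` (decomp-a2c, lens 2, g21 addendum = g22 head start)

Critic row 374 (2) ORDER for lens-2 g22: (a) type the law-level clean defect pricing
`L(θ) := ∃ c′ > 0 ∀ point-stationary δ-hard-core laws P with root a.s. (1/16, 9/10, 1)-clean: c′·P(root θ-unmatched) ≤ E_P[e_root] − e⋆`
over the door's law objects; (b) restate BULK / DILUTE at law level.  This file does the TYPING and the CHEAP KERNELS; the two transfer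
kernels (configuration ⟷ law: compactness of rooted hard-core laws / ball mass transport as in
`PalmUnimodularRigidityUnimodularEnergyLowerBound`) are XL and are NOT here.

The law class is EXACTLY the binder list of `ChartedPlanarOrderRigidityDoor.VisibleGap` (= the registered stub text c966ab35) minus its
a.s.-Nash and a.s.-charted binders, copied verbatim as the abbreviations `AsRooted`, `IsMecke`, `meanEnergy`, `AsClean` (§1), so that the
qualitative statement `LawMatching θ` (= L₀(θ)) implies `VisibleGap θ` by a bare hypothesis drop (`visibleGap_of_lawMatching`, `rfl`-level).

g21 v3 finding (node `ChartedPlanarOrderDensityDichotomy`, K5′ `sparseMisfit_of_bulk`): the door consumes only the energy-DENSITY gap BULK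
(«η⋆(u) > 0 ∀u»), not the linear rate.  At law level this reads: the door's two targets follow from the QUALITATIVE family {L₀(η)}_{η ≤ 1/16}
alone — `gap_and_pert_1_50_of_lawMatching` — and L₀ ⟸ BULK_law ⟸ L (`lawMatching_of_lawBulkGap`, `lawBulkGap_of_lawPricing`), with the
exact law-level structure theorem `lawPricing_iff_bulk_and_dilute : L(θ) ⟺ BULK_law(θ) ∧ DILUTE_law(θ)` (no floor is needed at law level:
the boundary and slack terms are gone).

Statements (θ = matching tolerance of `matchedAt`, `pBad θ P = (P {μ | ¬ matchedAt θ μ 0}).toReal`, `meanEnergy P = ∫ ½∫V_LJ‖y‖dμ dP`):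
* `LawMatching θ`   (L₀)        `∀δ>0 ∀P prob, AsRooted δ P → IsMecke P → meanEnergy P ≤ e⋆ → AsClean P → ∀ᵐ μ ∂P, matchedAt θ μ 0`
* `LawPricing θ`    (L, row 374) `∀δ>0 ∃c>0 ∀P prob, AsRooted δ P → IsMecke P → AsClean P → c·pBad θ P ≤ meanEnergy P − e⋆`
* `LawBulkGap θ`    (BULK_law)   `∀δ>0 ∀u∈(0,1] ∃η>0 ∀P …, u ≤ pBad θ P → η ≤ meanEnergy P − e⋆`
* `LawDiluteRate θ` (DILUTE_law) `∀δ>0 ∃u₀∈(0,1] ∃c>0 ∀P …, pBad θ P ≤ u₀ → c·pBad θ P ≤ meanEnergy P − e⋆`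
No integrability binder, ON PURPOSE: `LawMatching` must stay literally `VisibleGap` minus two binders; for a non-integrable `P` the Bochner
mean is `0` and the three quantitative statements read `… ≤ −e⋆`, satisfiable because `e⋆ < 0` (so their TRUE-type status is unaffected;
typing checklist 4c (ii) checked: no vacuity, no trivial falsity).

SIDE BY SIDE (order (b) dedup, texts read 2026-08-31): `StarCoercivity` (route ReggeStarCoercivity, l.343) = FINITE-CLUSTER linear pricing
`N·e⋆ + g·#{first-shell 1/20-defective} − C·N^{2/3} ≤ E_N(x)` for ALL injective x (no cleanliness; first-shell defect notion; surface term);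
`LjDefectCoercivity` (OneGrainWindow, l.270) = finite-cluster pricing against ONE periodic template, no surface term; `DefectFreeCrystallizes`
(13603) / `CleanLimitsHaveWindows` (15932) = ground-state-SEQUENCE statements (defect fraction → 0 ⇒ crystallization / periodic windows).
`LawPricing` is the law-level (N → ∞, surface-free, Palm) member of the same LINEAR-PRICING family, restricted to CLEAN laws and with the
two-way Barlow-template matching of `matchedAt` (4b/5b balls) as the defect notion — same currency family as StarCoercivity, NOT the same
statement (clean-only: weaker; Barlow matching instead of first-shell closeness: stronger per site; no kernel either way in the tree).
`LawMatching θ` vs lens-3's N-pieces: it IS `VisibleGap θ` with the Nash and charted binders deleted (GS-free, hence STRONGER than the stub);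
`PertRegime` follows from the family over η ≤ 1/16 exactly as in `pertRegime_of_door_sparse`, without door or SparseNull.
-/

open MeasureTheory Set
open Summit.AtomisticToContinuum.Crystallization.Theorems.ChartedPlanarOrderRigidityDoor

namespace Summit.AtomisticToContinuum.Crystallization.Theorems.ChartedPlanarOrderLawPricing

/-! ## 1. The law class of the door: `VisibleGap`'s binders, verbatim -/

/-- a.s. a rooted `δ`-hard-core counting measure (VisibleGap's first law binder, verbatim). -/
def AsRooted (δ : ℝ) (P : Measure (Measure E3)) : Prop :=
  ∀ᵐ μ ∂P, (∃ S : Set (EuclideanSpace ℝ (Fin 3)), (0 : EuclideanSpace ℝ (Fin 3)) ∈ S ∧ (∀ x ∈ S, ∀ y ∈ S, x ≠ y → δ ≤ dist x y) ∧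
    μ = (MeasureTheory.Measure.count : MeasureTheory.Measure (EuclideanSpace ℝ (Fin 3))).restrict S)

/-- the Mecke / point-stationarity identity (VisibleGap's second law binder, verbatim). -/
def IsMecke (P : Measure (Measure E3)) : Prop :=
  ∀ g : MeasureTheory.Measure (EuclideanSpace ℝ (Fin 3)) → EuclideanSpace ℝ (Fin 3) → ENNReal, Measurable (Function.uncurry g) →
    ∫⁻ μ, ∫⁻ y, g μ y ∂μ ∂P = ∫⁻ μ, ∫⁻ y, g (MeasureTheory.Measure.map (fun z => z - y) μ) (-y) ∂μ ∂P

/-- mean root energy `E_P[½ ∫ V_LJ ‖y‖ dμ]` (the left side of VisibleGap's energy binder, verbatim). -/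
noncomputable def meanEnergy (P : Measure (Measure E3)) : ℝ :=
  ∫ μ, (∫ y, Literature.MathematicalPhysics.StatisticalMechanics.lennardJones ‖y‖ ∂μ) / 2 ∂P

/-- a.s. every atom `(1/16, 9/10, 1)`-two-shell-clean (VisibleGap's cleanliness binder, verbatim). -/
def AsClean (P : Measure (Measure E3)) : Prop :=
  ∀ᵐ μ ∂P, ∀ q : EuclideanSpace ℝ (Fin 3), μ {q} ≠ 0 →
    Literature.Geometry.DiscreteGeometry.IsTwoShellGoodSet (1 / 16) (9 / 10) 1 {p : EuclideanSpace ℝ (Fin 3) | μ {p} ≠ 0} q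

/-- the root defect probability at tolerance `θ`. -/
noncomputable def pBad (θ : ℝ) (P : Measure (Measure E3)) : ℝ := (P {μ | ¬ matchedAt θ μ 0}).toReal

/-- `pBad ≥ 0`. -/
theorem pBad_nonneg (θ : ℝ) (P : Measure (Measure E3)) : 0 ≤ pBad θ P := ENNReal.toReal_nonneg

/-- `pBad ≤ 1` for a probability law. -/
theorem pBad_le_one (θ : ℝ) (P : Measure (Measure E3)) [IsProbabilityMeasure P] : pBad θ P ≤ 1 := by
  unfold pBad
  have h := ENNReal.toReal_mono ENNReal.one_ne_top (prob_le_one (μ := P) (s := {μ | ¬ matchedAt θ μ 0}))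
  simpa using h

/-- `pBad θ P = 0` iff the root is a.s. `θ`-matched. -/
theorem ae_matched_of_pBad_eq_zero {θ : ℝ} {P : Measure (Measure E3)} [IsProbabilityMeasure P] (h : pBad θ P = 0) :
    ∀ᵐ μ ∂P, matchedAt θ μ 0 := by
  unfold pBad at h
  rcases (ENNReal.toReal_eq_zero_iff _).1 h with h0 | htop
  · have h1 := (measure_eq_zero_iff_ae_notMem (μ := P)).1 h0
    filter_upwards [h1] with μ hμ
    simpa using hμ
  · exact absurd htop (measure_ne_top P _)

/-! ## 2. The law-level statements -/

/-- **L₀(θ) · `LawMatching θ`** — qualitative law matching: `VisibleGap θ` with the a.s.-Nash and a.s.-charted binders deleted (GS-free). -/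
def LawMatching (θ : ℝ) : Prop :=
  ∀ δ : ℝ, 0 < δ → ∀ P : Measure (Measure E3), IsProbabilityMeasure P → AsRooted δ P → IsMecke P → meanEnergy P ≤ eStar →
    AsClean P → ∀ᵐ μ ∂P, matchedAt θ μ 0

/-- **L(θ) · `LawPricing θ`** (critic row 374): linear law-level clean defect pricing. -/
def LawPricing (θ : ℝ) : Prop :=
  ∀ δ : ℝ, 0 < δ → ∃ c : ℝ, 0 < c ∧ ∀ P : Measure (Measure E3), IsProbabilityMeasure P → AsRooted δ P → IsMecke P → AsClean P →
    c * pBad θ P ≤ meanEnergy P - eStar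

/-- **BULK_law(θ) · `LawBulkGap θ`** — defect probability `≥ u` forces a mean-energy gap `η(u) > 0`. -/
def LawBulkGap (θ : ℝ) : Prop :=
  ∀ δ : ℝ, 0 < δ → ∀ u : ℝ, 0 < u → u ≤ 1 → ∃ η : ℝ, 0 < η ∧ ∀ P : Measure (Measure E3), IsProbabilityMeasure P → AsRooted δ P →
    IsMecke P → AsClean P → u ≤ pBad θ P → η ≤ meanEnergy P - eStar

/-- **DILUTE_law(θ) · `LawDiluteRate θ`** — linear pricing below a defect-probability threshold `u₀` of the statement's choosing. -/
def LawDiluteRate (θ : ℝ) : Prop :=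
  ∀ δ : ℝ, 0 < δ → ∃ u₀ : ℝ, 0 < u₀ ∧ u₀ ≤ 1 ∧ ∃ c : ℝ, 0 < c ∧ ∀ P : Measure (Measure E3), IsProbabilityMeasure P → AsRooted δ P →
    IsMecke P → AsClean P → pBad θ P ≤ u₀ → c * pBad θ P ≤ meanEnergy P - eStar

/-! ## 3. Cheap kernels (0 sorry) -/

/-- L ⟹ BULK_law (`η = c·u`). -/
theorem lawBulkGap_of_lawPricing {θ : ℝ} (h : LawPricing θ) : LawBulkGap θ := by
  intro δ hδ u hu _hu1
  obtain ⟨c, hc, h⟩ := h δ hδ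
  refine ⟨c * u, by positivity, fun P hP h1 h2 h3 hub => ?_⟩
  have key := h P hP h1 h2 h3
  have : c * u ≤ c * pBad θ P := mul_le_mul_of_nonneg_left hub hc.le
  linarith

/-- L ⟹ DILUTE_law (`u₀ = 1`). -/
theorem lawDiluteRate_of_lawPricing {θ : ℝ} (h : LawPricing θ) : LawDiluteRate θ := by
  intro δ hδ
  obtain ⟨c, hc, h⟩ := h δ hδ
  exact ⟨1, one_pos, le_rfl, c, hc, fun P hP h1 h2 h3 _ => h P hP h1 h2 h3⟩

/-- BULK_law ∧ DILUTE_law ⟹ L (`c = min c_D (η(u₀))`; dichotomy `pBad ≤ u₀ ∨ u₀ < pBad`). -/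
theorem lawPricing_of_bulk_dilute {θ : ℝ} (hB : LawBulkGap θ) (hD : LawDiluteRate θ) : LawPricing θ := by
  intro δ hδ
  obtain ⟨u₀, hu₀, hu₀1, cD, hcD, hD'⟩ := hD δ hδ
  obtain ⟨η, hη, hB'⟩ := hB δ hδ u₀ hu₀ hu₀1
  refine ⟨min cD η, lt_min hcD hη, fun P hP h1 h2 h3 => ?_⟩
  have hp0 : 0 ≤ pBad θ P := pBad_nonneg θ P
  have hp1 : pBad θ P ≤ 1 := pBad_le_one θ P
  rcases le_or_gt (pBad θ P) u₀ with hle | hgt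
  · have key := hD' P hP h1 h2 h3 hle
    have : min cD η * pBad θ P ≤ cD * pBad θ P := mul_le_mul_of_nonneg_right (min_le_left _ _) hp0
    linarith
  · have key := hB' P hP h1 h2 h3 hgt.le
    have h4 : min cD η * pBad θ P ≤ η * pBad θ P := mul_le_mul_of_nonneg_right (min_le_right _ _) hp0
    have h5 : η * pBad θ P ≤ η * 1 := mul_le_mul_of_nonneg_left hp1 hη.le
    linarith

/-- the exact law-level structure theorem: **L ⟺ BULK_law ∧ DILUTE_law** (no floor needed at law level). -/
theorem lawPricing_iff_bulk_and_dilute (θ : ℝ) : LawPricing θ ↔ LawBulkGap θ ∧ LawDiluteRate θ :=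
  ⟨fun h => ⟨lawBulkGap_of_lawPricing h, lawDiluteRate_of_lawPricing h⟩, fun h => lawPricing_of_bulk_dilute h.1 h.2⟩

/-- BULK_law ⟹ L₀: a law with mean energy `≤ e⋆` and positive defect probability contradicts the gap at `u = min 1 (pBad)`. -/
theorem lawMatching_of_lawBulkGap {θ : ℝ} (hB : LawBulkGap θ) : LawMatching θ := by
  intro δ hδ P hP h1 h2 hen h3
  have hp0 : 0 ≤ pBad θ P := pBad_nonneg θ P
  rcases hp0.lt_or_eq with hpos | hzero
  · exfalso
    obtain ⟨η, hη, hB'⟩ := hB δ hδ (min 1 (pBad θ P)) (lt_min one_pos hpos) (min_le_left _ _)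
    have key := hB' P hP h1 h2 h3 (min_le_right _ _)
    linarith
  · exact ae_matched_of_pBad_eq_zero hzero.symm

/-- L ⟹ L₀. -/
theorem lawMatching_of_lawPricing {θ : ℝ} (h : LawPricing θ) : LawMatching θ :=
  lawMatching_of_lawBulkGap (lawBulkGap_of_lawPricing h)

/-! ## 4. Consumption WITHOUT the door: both targets of `ChartedPlanarOrder` from the qualitative family {L₀(η)} -/

/-- **L₀(θ) ⟹ GAP(θ)** — a bare hypothesis drop (`VisibleGap`'s Nash and charted binders are not used). -/
theorem visibleGap_of_lawMatching {θ : ℝ} (h : LawMatching θ) : VisibleGap θ :=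
  fun δ hδ P hP hroot hmecke hen hclean _ _ => h δ hδ P hP hroot hmecke hen hclean

/-- **{L₀(η)}_{η ≤ 1/16} ⟹ PERT(ν)** — the countable-tolerance argument of `pertRegime_of_door_sparse`, with no door and no SparseNull. -/
theorem pertRegime_of_lawMatching (ν : ℝ) (h : ∀ η : ℝ, 0 < η → η ≤ 1 / 16 → LawMatching η) : PertRegime ν := by
  intro δ hδ P hP hroot hmecke hen hclean _hnash _hchart _hall
  have hη : ∀ n : ℕ, (0 : ℝ) < 1 / ((n : ℝ) + 16) ∧ 1 / ((n : ℝ) + 16) ≤ 1 / 16 := by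
    intro n
    refine ⟨by positivity, ?_⟩
    exact one_div_le_one_div_of_le (by norm_num) (by linarith [n.cast_nonneg (α := ℝ)])
  have hn : ∀ n : ℕ, ∀ᵐ μ ∂P, matchedAt (1 / ((n : ℝ) + 16)) μ 0 := fun n =>
    h _ (hη n).1 (hη n).2 δ hδ P hP hroot hmecke hen hclean
  have hall : ∀ᵐ μ ∂P, ∀ n : ℕ, matchedAt (1 / ((n : ℝ) + 16)) μ 0 := ae_all_iff.2 hn
  filter_upwards [hall] with μ hμ
  intro η hη0
  obtain ⟨n, hnη⟩ := exists_nat_one_div_lt hη0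
  have hle : 1 / ((n : ℝ) + 16) ≤ η := by
    have : 1 / ((n : ℝ) + 16) ≤ 1 / ((n : ℝ) + 1) := one_div_le_one_div_of_le (by positivity) (by linarith)
    exact this.trans hnη.le
  exact matchedAt_mono hle (hμ n)

/-- both door targets at the dial `1/50` from the qualitative law family. -/
theorem gap_and_pert_1_50_of_lawMatching (h : ∀ η : ℝ, 0 < η → η ≤ 1 / 16 → LawMatching η) :
    VisibleGap (1 / 50) ∧ PertRegime (1 / 50) :=
  ⟨visibleGap_of_lawMatching (h _ (by norm_num) (by norm_num)), pertRegime_of_lawMatching _ h⟩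

/-- … from the law-level density gap BULK_law. -/
theorem gap_and_pert_1_50_of_lawBulkGap (h : ∀ η : ℝ, 0 < η → η ≤ 1 / 16 → LawBulkGap η) :
    VisibleGap (1 / 50) ∧ PertRegime (1 / 50) :=
  gap_and_pert_1_50_of_lawMatching fun η hη hη' => lawMatching_of_lawBulkGap (h η hη hη')

/-- … from the critic's linear pricing L. -/
theorem gap_and_pert_1_50_of_lawPricing (h : ∀ η : ℝ, 0 < η → η ≤ 1 / 16 → LawPricing η) :
    VisibleGap (1 / 50) ∧ PertRegime (1 / 50) :=
  gap_and_pert_1_50_of_lawMatching fun η hη hη' => lawMatching_of_lawPricing (h η hη hη')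

end Summit.AtomisticToContinuum.Crystallization.Theorems.ChartedPlanarOrderLawPricing
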